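import Summits.QuantumAdvantage.QuantumAdvantage.Theses.LinnikCubicClassGroups

/-!
# Crux `LinnikCubicClassGroups.PureCubicClassGroupFBQP` (stmt-QuantumAdvantage-11544) — stub `stub_coreOrderCanonical`

Line `arakelov-giant-step-cycle`, stub S5a (pure algebra): for a non-cube `m` and any list of rational
primes `ps`, the order of the subgroup of `Cl(𝓞 K)` generated by the classes of the prime ideals of
norm `p ∈ ps` is the same for all cubic number fields `K ∋ ∛m`.

Proof: the first hypothesis (stub S3c) gives a `ℚ`-algebra isomorphism `e : K ≃ₐ[ℚ] K'` between any
two admissible fields; it restricts to a ring isomorphism `E : 𝓞 K ≃+* 𝓞 K'`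
(`NumberField.RingOfIntegers.mapRingEquiv`). Along `E` (made into an `Algebra (𝓞 K) (𝓞 K')`
instance) Mathlib's `ClassGroup.extendedHom` is a group homomorphism `Cl(𝓞 K) → Cl(𝓞 K')` sending
`mk0 P` to `mk0 (P.map E)` (`ClassGroup.extendedHom_mk0`). A ring isomorphism maps prime ideals to
prime ideals, nonzero ideals to nonzero ideals, and preserves the absolute norm
(`𝓞 K ⧸ P ≃ 𝓞 K' ⧸ E(P)`), so every generator `mk0 Q` on the `K'` side is the image of the generator
`mk0 (Q.map E⁻¹)` on the `K` side. Hence the generated subgroup on the `K'` side is contained in the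
image of the generated subgroup on the `K` side, which bounds its (finite) order by the order on the
`K` side. The same argument along `E⁻¹` gives the reverse inequality.
-/

namespace Summit.QuantumAdvantage.QuantumAdvantage.Theorems.LinnikCubicClassGroups

open scoped NumberField nonZeroDivisors

/-- The absolute norm of an ideal is invariant under ring isomorphisms (`R ⧸ I ≃ S ⧸ E(I)`). -/
theorem absNorm_map_ringEquiv_eq {R S : Type*} [CommRing R] [CommRing S] [IsDedekindDomain R]
    [Module.Free ℤ R] [IsDedekindDomain S] [Module.Free ℤ S] (E : R ≃+* S) (I : Ideal R) :
    Ideal.absNorm (I.map (E : R →+* S)) = Ideal.absNorm I := by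
  rw [Ideal.absNorm_apply, Ideal.absNorm_apply, Submodule.cardQuot_apply, Submodule.cardQuot_apply]
  exact (Nat.card_congr (Ideal.quotientEquiv I (I.map (E : R →+* S)) E rfl).toEquiv).symm

/-- One direction of the transport: along a ring isomorphism `E : 𝓞 K ≃+* 𝓞 K'`, the subgroup of
`Cl(𝓞 K')` generated by the classes of the prime ideals of norm `p ∈ ps` is contained in the image
under `ClassGroup.extendedHom` of the corresponding subgroup of `Cl(𝓞 K)`, so its order is at most
the order of the latter. -/
theorem card_closure_primeClasses_le_of_ringEquiv (K K' : Type*) [Field K] [NumberField K]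
    [Field K'] [NumberField K'] (E : 𝓞 K ≃+* 𝓞 K') (ps : List ℕ) :
    Nat.card (Subgroup.closure {c : ClassGroup (𝓞 K') | ∃ p ∈ ps, ∃ P : Ideal (𝓞 K'),
        ∃ hP : P ∈ nonZeroDivisors (Ideal (𝓞 K')),
          P.IsPrime ∧ Ideal.absNorm P = p ∧ c = ClassGroup.mk0 ⟨P, hP⟩}) ≤
      Nat.card (Subgroup.closure {c : ClassGroup (𝓞 K) | ∃ p ∈ ps, ∃ P : Ideal (𝓞 K),
        ∃ hP : P ∈ nonZeroDivisors (Ideal (𝓞 K)),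
          P.IsPrime ∧ Ideal.absNorm P = p ∧ c = ClassGroup.mk0 ⟨P, hP⟩}) := by
  letI : Algebra (𝓞 K) (𝓞 K') := E.toRingHom.toAlgebra
  haveI : Module.IsTorsionFree (𝓞 K) (𝓞 K') :=
    Module.isTorsionFree_iff_algebraMap_injective.mpr E.injective
  have hle : Subgroup.closure {c : ClassGroup (𝓞 K') | ∃ p ∈ ps, ∃ P : Ideal (𝓞 K'),
        ∃ hP : P ∈ nonZeroDivisors (Ideal (𝓞 K')),
          P.IsPrime ∧ Ideal.absNorm P = p ∧ c = ClassGroup.mk0 ⟨P, hP⟩} ≤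
      (Subgroup.closure {c : ClassGroup (𝓞 K) | ∃ p ∈ ps, ∃ P : Ideal (𝓞 K),
        ∃ hP : P ∈ nonZeroDivisors (Ideal (𝓞 K)),
          P.IsPrime ∧ Ideal.absNorm P = p ∧ c = ClassGroup.mk0 ⟨P, hP⟩}).map
        (ClassGroup.extendedHom (𝓞 K) (𝓞 K')) := by
    rw [Subgroup.closure_le]
    rintro c ⟨p, hp, Q, hQ, hQprime, hQnorm, rfl⟩
    have hP : Q.map (E.symm : 𝓞 K' →+* 𝓞 K) ∈ nonZeroDivisors (Ideal (𝓞 K)) := by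
      rw [mem_nonZeroDivisors_iff_ne_zero] at hQ ⊢
      exact fun h => hQ ((Ideal.map_eq_bot_iff_of_injective E.symm.injective).mp h)
    have hPprime : (Q.map (E.symm : 𝓞 K' →+* 𝓞 K)).IsPrime :=
      Ideal.map_isPrime_of_equiv E.symm
    have hPQ : (Q.map (E.symm : 𝓞 K' →+* 𝓞 K)).map (E : 𝓞 K →+* 𝓞 K') = Q := by
      rw [Ideal.map_map, RingEquiv.comp_symm, Ideal.map_id]
    refine ⟨ClassGroup.mk0 ⟨Q.map (E.symm : 𝓞 K' →+* 𝓞 K), hP⟩,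
      Subgroup.subset_closure ⟨p, hp, _, hP, hPprime, ?_, rfl⟩, ?_⟩
    · rw [absNorm_map_ringEquiv_eq, hQnorm]
    · rw [ClassGroup.extendedHom_mk0]
      congr 1
      exact Subtype.ext hPQ
  calc Nat.card _ ≤ Nat.card _ := Subgroup.card_le_of_le hle
    _ ≤ Nat.card _ := Nat.le_of_dvd Nat.card_pos (Subgroup.card_map_dvd _ _)

/-- **stub_coreOrderCanonical** (S5a). For a non-cube `m` and any list of rational primes `ps`, the
order of the subgroup of `Cl(𝓞 K)` generated by the classes of the prime ideals of norm `p ∈ ps` is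
the same for all cubic number fields `K ∋ ∛m`: the first hypothesis (stub S3c) makes any two such
fields `ℚ`-isomorphic, and the count is transported along the induced isomorphism of rings of
integers in both directions (`card_closure_primeClasses_le_of_ringEquiv`). -/
theorem stub_coreOrderCanonical :
    (∀ m : ℕ, (∀ r : ℕ, r ^ 3 ≠ m) →
      ∀ (K : Type) [Field K] [NumberField K] (K' : Type) [Field K'] [NumberField K'],
        Module.finrank ℚ K = 3 → Module.finrank ℚ K' = 3 →
        ∀ (α : K) (α' : K'), α ^ 3 = (m : K) → α' ^ 3 = (m : K') →
        (∃ e : K ≃ₐ[ℚ] K', e α = α') ∧ NumberField.Units.regulator K = NumberField.Units.regulator K') →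
    ∀ (m : ℕ) (ps : List ℕ), (∀ r : ℕ, r ^ 3 ≠ m) →
      ∀ (K : Type) [Field K] [NumberField K] (K' : Type) [Field K'] [NumberField K'],
        Module.finrank ℚ K = 3 → (∃ α : K, α ^ 3 = (m : K)) →
        Module.finrank ℚ K' = 3 → (∃ α' : K', α' ^ 3 = (m : K')) →
        Nat.card (Subgroup.closure {c : ClassGroup (𝓞 K) | ∃ p ∈ ps, ∃ P : Ideal (𝓞 K),
            ∃ hP : P ∈ nonZeroDivisors (Ideal (𝓞 K)), P.IsPrime ∧ Ideal.absNorm P = p ∧ c = ClassGroup.mk0 ⟨P, hP⟩}) =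
          Nat.card (Subgroup.closure {c : ClassGroup (𝓞 K') | ∃ p ∈ ps, ∃ P : Ideal (𝓞 K'),
            ∃ hP : P ∈ nonZeroDivisors (Ideal (𝓞 K')), P.IsPrime ∧ Ideal.absNorm P = p ∧ c = ClassGroup.mk0 ⟨P, hP⟩}) := by
  intro hadm m ps hm K _ _ K' _ _ hK ⟨α, hα⟩ hK' ⟨α', hα'⟩
  obtain ⟨⟨e, -⟩, -⟩ := hadm m hm K K' hK hK' α α' hα hα'
  exact le_antisymm
    (card_closure_primeClasses_le_of_ringEquiv K' K
      (NumberField.RingOfIntegers.mapRingEquiv e.toRingEquiv).symm ps)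
    (card_closure_primeClasses_le_of_ringEquiv K K'
      (NumberField.RingOfIntegers.mapRingEquiv e.toRingEquiv) ps)

end Summit.QuantumAdvantage.QuantumAdvantage.Theorems.LinnikCubicClassGroups
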